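import Summits.Ventures.Crystal3D.Theorems.StickyWulffConstantCoaxialWallLawReadingDirectionsApex
import HarnessLib

/-!
# Reading directions V: a STANDARD reader at a module ball reads only module sites and first-generation apex positions
# (crux `CoaxialWallLaw`, stmt-Ventures-19481, line `WallLedgerF`; T4 brick, census-free)

HONEST FRAMING. Venture `Summits/Ventures/Crystal3D` (cell `crystal3d-full`); helper `--supports` the crux `CoaxialWallLaw`
(stmt-Ventures-19481, `route-Ventures-StickyWulffConstant`), REGISTERED line `WallLedgerF` (planner cf-p1, (xcv)(1): T4 pieces first).
Census-free; F-C1 not moved.  Continues `…ReadingDirections` / `…Apex`: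
* `vint_cases_table` (`decide`): every vector of `VInt` is `siteFine` of a menu offset or `apexFine` of an adjacent menu pair;
  `readingDir_cases` — a reading direction is a module bond `modSite m` or a first-generation apex vector;
* `exists_stdIso_of_stdFrame` — a `StdFrame` has the slot dozen of one of the eight `stdIso j`; `mem_readingDirs_of_stdFrame` — the slots
  of a standard placement are reading directions;
* **`position_of_stdFrame`** — for a standard placement `G`, a slot `w` and a site `s`, the read position `modSite s + G w` is the module
  site `modSite (addSite s m)` of a menu offset `m`, or the apex position `modSite s + apexVec (modSite a) (modSite b) up` of an adjacent menu
  pair — so a ball that is at NO such position (loose dust) is never read by a standard reader sitting at a module ball (C3 of F-TAIL-g9 §8).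
WHAT THIS IS NOT: not the dust analysis for apex-ball readers, not type soundness; F-C1 not moved.
-/

noncomputable section

namespace Summit.Ventures.Crystal3D.Theorems

namespace TailResidue

open Summit.Ventures.Crystal3D Finset NearIdentity
open Literature.MathematicalPhysics.StatisticalMechanics (basalMirror)
open scoped InnerProductSpace

set_option maxRecDepth 65536 in
/-- Table (kernel `decide`): `VInt = siteFine '' menu ∪ apexFine '' (adjacent pairs × sides)`. -/
theorem vint_cases_table : ∀ t ∈ VInt,
    (∃ m ∈ menuOffsets, siteFine m = t) ∨ (∃ p ∈ menuPairs, apexFine p.1 p.2 true = t ∨ apexFine p.1 p.2 false = t) := by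
  decide

set_option maxRecDepth 65536 in
/-- **A reading direction is a module bond or a first-generation apex vector.** -/
theorem readingDir_cases {v : EuclideanSpace ℝ (Fin 3)} (hv : v ∈ readingDirs) :
    (∃ m ∈ menuOffsets, v = modSite m) ∨
      ∃ ab ∈ menuPairs, ∃ up : Bool, v = apexVec (modSite ab.1) (modSite ab.2) up := by
  obtain ⟨t, ht, rfl⟩ := hv
  rcases vint_cases_table t ht with ⟨m, hm, hmt⟩ | ⟨p, hp, hpt⟩
  · exact Or.inl ⟨m, hm, by rw [modSite_eq_fineVec, hmt]⟩
  · right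
    refine ⟨p, hp, ?_⟩
    have hp' : (p.1, p.2) ∈ menuPairs := hp
    rcases hpt with h | h
    · exact ⟨true, by rw [apexVec_modSite hp', h]⟩
    · exact ⟨false, by rw [apexVec_modSite hp', h]⟩

/-- **A `StdFrame` has the slot dozen of one of the eight standard isometries.** -/
theorem exists_stdIso_of_stdFrame {G : EuclideanSpace ℝ (Fin 3) ≃ₗᵢ[ℝ] EuclideanSpace ℝ (Fin 3)} (h : StdFrame G) :
    ∃ j : Fin 8, (G : EuclideanSpace ℝ (Fin 3) → EuclideanSpace ℝ (Fin 3)) '' ↑fccSlots =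
      (stdIso j : EuclideanSpace ℝ (Fin 3) → EuclideanSpace ℝ (Fin 3)) '' ↑fccSlots := by
  rcases h with h | h | ⟨c, hc, h⟩ | ⟨c, hc, h⟩
  · exact ⟨1, by rw [h]; simp [stdIso]⟩
  · exact ⟨0, h⟩
  · fin_cases c
    · exact ⟨3, by rw [h]; simp only [stdIso, coe_inclIso]; rfl⟩
    · exact ⟨6, by rw [h]; simp only [stdIso, coe_inclIso]; rfl⟩
    · exact ⟨5, by rw [h]; simp only [stdIso, coe_inclIso]; rfl⟩
    · exact absurd hc (by decide)
    · exact absurd hc (by decide)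
    · exact absurd hc (by decide)
  · fin_cases c
    · exact absurd hc (by decide)
    · exact absurd hc (by decide)
    · exact absurd hc (by decide)
    · exact ⟨2, by rw [h]; simp only [stdIso, LinearIsometryEquiv.coe_trans, Set.image_comp, coe_inclIso]; rfl⟩
    · exact ⟨7, by rw [h]; simp only [stdIso, LinearIsometryEquiv.coe_trans, Set.image_comp, coe_inclIso]; rfl⟩
    · exact ⟨4, by rw [h]; simp only [stdIso, LinearIsometryEquiv.coe_trans, Set.image_comp, coe_inclIso]; rfl⟩

/-- **The slots of a standard placement are reading directions.** -/
theorem mem_readingDirs_of_stdFrame {G : EuclideanSpace ℝ (Fin 3) ≃ₗᵢ[ℝ] EuclideanSpace ℝ (Fin 3)} (h : StdFrame G)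
    {w : EuclideanSpace ℝ (Fin 3)} (hw : w ∈ fccSlots) : G w ∈ readingDirs := by
  obtain ⟨j, hj⟩ := exists_stdIso_of_stdFrame h
  have hmem : G w ∈ (stdIso j : EuclideanSpace ℝ (Fin 3) → EuclideanSpace ℝ (Fin 3)) '' ↑fccSlots := by
    rw [← hj]; exact ⟨w, Finset.mem_coe.2 hw, rfl⟩
  obtain ⟨u, hu, hGu⟩ := hmem
  obtain ⟨k, rfl⟩ := exists_slotSite_eq (Finset.mem_coe.1 hu)
  rw [← hGu]
  exact stdIso_slotSite_mem_readingDirs j k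

/-- **A STANDARD READER AT A MODULE BALL READS ONLY MODULE SITES AND FIRST-GENERATION APEX POSITIONS.** -/
theorem position_of_stdFrame {G : EuclideanSpace ℝ (Fin 3) ≃ₗᵢ[ℝ] EuclideanSpace ℝ (Fin 3)} (h : StdFrame G)
    {w : EuclideanSpace ℝ (Fin 3)} (hw : w ∈ fccSlots) (s : ℤ × ℤ × ℤ) :
    (∃ m ∈ menuOffsets, modSite s + G w = modSite (addSite s m)) ∨
      ∃ ab ∈ menuPairs, ∃ up : Bool, modSite s + G w = modSite s + apexVec (modSite ab.1) (modSite ab.2) up := by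
  rcases readingDir_cases (mem_readingDirs_of_stdFrame h hw) with ⟨m, hm, hGw⟩ | ⟨ab, hab, up, hGw⟩
  · refine Or.inl ⟨m, hm, ?_⟩
    rw [hGw, modSite, modSite, modSite, addSite]
    push_cast
    module
  · exact Or.inr ⟨ab, hab, up, by rw [hGw]⟩

end TailResidue

end Summit.Ventures.Crystal3D.Theorems

end
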